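import Summits.Ventures.HSemireg.WedgeHankelTwoFiniteNodes

/-!
# Venture HSemireg — THE MÖBIUS BOOKKEEPING: the swap past the frame change, `Ψs ∘ Φs ν = Φs ν⁻¹ ∘ (x-scaling ∘ Δs ∘ Ls)`, hence «the reversal of a node-`ν` class is a
# node-`ν⁻¹` class of the same order» — the sequence identity gen 15 named as the obstacle, obtained from an identity of automorphisms; and the four generators' actions on nodes

HONEST FRAMING. Part of the Lean index of the computation cell `pub-hsemireg` (seat p10 gen 16, Sunday typer «UNIFORM-IN-n»).
Finite-dimensional EXTERIOR ALGEBRA over a field ONLY: no variety, no cohomology theory, no sheaf, no Ext group, no semiregularity map;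
nothing here says that HC / HC_CM / HC_AV holds; no Literature fact is declared or used.  Custodian versions as in `WedgeHankelSiegelIdeal` (1/3) and `WedgeHankelFrameChange`;
the dictionary (nodes of a class; the Möbius action `ν ↦ (aν + b)/(cν + d)` of a frame change on the nodes) is QUOTED, never asserted.

WHAT IS IN THE TREE.  E5 `Φs a` (`ν ↦ ν + a`; classes `expMul a`), E7 `Ψs` (`0 ↔ ∞`; classes `rev_n`), E12 `Δs m` (`ν ↦ νm`; `scaleSeq m`), F1 `Ls c` (`ν ↦ ν/(1 + cν)`; `lowMul c`),
`algEquiv_ext_XY`, and the Bruhat-type identity `Ls_neg_Φs` (a finite node to `∞`).  E9's header named the missing SEQUENCE identity: `rev_n ∘ expMul ν` on a polynomial sequence is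
`expMul ν⁻¹` of another polynomial sequence of the same degree.  THIS FILE proves it structurally and completes the generators' actions on node classes:
* §74 the x-SCALING `Xsc d := Ψs ∘ Δs d ∘ Ψs` (`x_a ↦ d x_a`, `y_a ↦ y_a`; classes `q_j ↦ d^{n−j} q_j` on `[0, n]`, `Xsc_w`); order at `0` preserved.
* §75 **`Ψs_Φs`: `Ψs ∘ Φs ν = Φs ν⁻¹ ∘ Xsc ν ∘ Δs (−ν⁻¹) ∘ Ls ν⁻¹`** (`ν ≠ 0`; the `2 × 2` identity `W·[[1,0],[ν,1]] = [[1,0],[ν⁻¹,1]]·[[ν,1],[0,−ν⁻¹]]`), hence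
  **`w_rev_expMul`: `w_n(rev_n (expMul ν q)) = w_n(expMul ν⁻¹ q′)`** with `q′ = xsSeq ν (scaleSeq (−ν⁻¹) (lowMul ν⁻¹ q))` explicit and of the SAME exact order as `q`
  (`xsSeq_…`, F1's `lowMul_apply_…`) — the reversal of a node-`ν` class of order `P + 1` is a node-`ν⁻¹` class of order `P + 1`; so **`Kr_w_rev_expMul_of_order`**:
  `Kr(univ, w_n(rev_n(expMul ν q)), k) = SI_k ⊔ Φs ν⁻¹ (xRich(k, P))` (`k + P ≤ n`).
* §76 the scaling on node classes: `scaleSeq_expMul` (`Δs m`: node `ν ↦ mν`, order kept; `Kr_w_scaleSeq_expMul_of_order`); with E9's `expMul_expMul` (`Φs a`: `ν ↦ ν + a`) and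
  F1's `Ls_neg_Φs` (`Ls(−ν⁻¹)`: `ν ↦ ∞`) every generator's action on a node class is in the tree or keyed.
* §77 **`Ls_Φs`: `Ls c ∘ Φs ν = Φs (ν(1+cν)⁻¹) ∘ Xsc (1+cν) ∘ Δs (1+cν)⁻¹ ∘ Ls (c(1+cν)⁻¹)`** (`1 + cν ≠ 0`): the lower shear moves the node `ν` to `ν/(1+cν)`
  (`w_lowMul_expMul`, `Kr_w_lowMul_expMul_of_order`); so for EVERY generator `g` of the `GL₂`-action and every node-`ν` class, `g·(class)` is a node-`g·ν` class of the same order.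
NOT typed here: a syntax of words in the generators with the induced `PGL₂`-action on divisors as one theorem (each generator is covered).  Class side only.
Namespace `Summit.Ventures.HSemireg.Wedge.HankelFrameChange` (continued); new names only.
-/

open Module

namespace Summit.Ventures.HSemireg.Wedge.HankelFrameChange

open Summit.Ventures.HSemireg.Wedge Summit.Ventures.HSemireg.Wedge.Kunneth Summit.Ventures.HSemireg.Wedge.Hankel
  Summit.Ventures.HSemireg.Wedge.BasisFree Summit.Ventures.HSemireg.Wedge.HankelSiegel Summit.Ventures.HSemireg.Wedge.HankelSiegelIdeal
  Summit.Ventures.HSemireg.Wedge.KunnethKernel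

variable (K : Type*) [Field K] {n : ℕ}

/-! ## §74. The x-scaling -/

/-- **THE x-SCALING `Xsc d := Ψs ∘ Δs d ∘ Ψs`** (`d ≠ 0`): `x_a ↦ d x_a`, `y_a ↦ y_a`. -/
noncomputable def Xsc {d : K} (hd : d ≠ 0) : HT K (In n) ≃ₐ[K] HT K (In n) := ((Ψs K (n := n)).trans (Δs K hd)).trans (Ψs K)

/-- `Xsc d f = Ψs (Δs d (Ψs f))`. -/
lemma Xsc_apply {d : K} (hd : d ≠ 0) (f : HT K (In n)) : Xsc K hd f = Ψs K (Δs K hd (Ψs K f)) := rfl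

/-- **`Xsc d (x_a) = d x_a`.** -/
theorem Xsc_X {d : K} (hd : d ≠ 0) (a : Fin n) : Xsc K (n := n) hd (X K n a) = d • X K n a := by
  rw [Xsc_apply, Ψs_X, Δs_Y, map_smul, Ψs_Y]

/-- **`Xsc d (y_a) = y_a`.** -/
theorem Xsc_Y {d : K} (hd : d ≠ 0) (a : Fin n) : Xsc K (n := n) hd (Y K n a) = Y K n a := by
  rw [Xsc_apply, Ψs_Y, Δs_X, Ψs_X]

/-- the coefficient action of the x-scaling: `xsSeq d q := rev_n (scaleSeq d (rev_n q))`, i.e. `q_j ↦ d^{n−j} q_j` on `[0, n]`. -/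
def xsSeq (n : ℕ) (d : K) (q : ℕ → K) : ℕ → K := rev K n (scaleSeq K d (rev K n q))

/-- `(xsSeq d q)_j = d^{n−j} q_j` for `j ≤ n`. -/
lemma xsSeq_apply_of_le (d : K) (q : ℕ → K) {j : ℕ} (hj : j ≤ n) : xsSeq K n d q j = d ^ (n - j) * q j := by
  rw [xsSeq, rev_apply_of_le K hj, scaleSeq, rev_apply_of_le K (Nat.sub_le n j), show n - (n - j) = j by omega]

/-- `(xsSeq d q)_j = 0` for `j > n`. -/
lemma xsSeq_apply_of_lt (d : K) (q : ℕ → K) {j : ℕ} (hj : n < j) : xsSeq K n d q j = 0 := by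
  rw [xsSeq, rev_apply_of_lt K hj]

/-- **`Xsc d (w_n(q)) = w_n(xsSeq d q)`.** -/
theorem Xsc_w {d : K} (hd : d ≠ 0) (q : ℕ → K) : Xsc K (n := n) hd (w K n n q) = w K n n (xsSeq K n d q) := by
  rw [Xsc_apply, Ψs_w K le_rfl, Δs_w K hd le_rfl, Ψs_w K le_rfl]; rfl

/-- a node at `0` keeps its order under the x-scaling: support … -/
lemma xsSeq_apply_eq_zero (d : K) {P : ℕ} {q : ℕ → K} (hq : ∀ j, P < j → q j = 0) {j : ℕ} (hj : P < j) : xsSeq K n d q j = 0 := by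
  by_cases hjn : j ≤ n
  · rw [xsSeq_apply_of_le K d q hjn, hq j hj, mul_zero]
  · exact xsSeq_apply_of_lt K d q (by omega)

/-- … and leading entry `d^{n−P} q_P`. -/
lemma xsSeq_apply_self (d : K) {P : ℕ} (hP : P ≤ n) (q : ℕ → K) : xsSeq K n d q P = d ^ (n - P) * q P := xsSeq_apply_of_le K d q hP

/-! ## §75. The swap past the frame change -/

/-- **`Ψs ∘ Φs ν = Φs ν⁻¹ ∘ Xsc ν ∘ Δs (−ν⁻¹) ∘ Ls ν⁻¹`** (`ν ≠ 0`): both sides send `x_a ↦ y_a + ν x_a` and `y_a ↦ x_a` (F1's `algEquiv_ext_XY`). -/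
theorem Ψs_Φs {nu : K} (hnu : nu ≠ 0) (hc : -nu⁻¹ ≠ 0) (f : HT K (In n)) :
    Ψs K (Φs K nu f) = Φs K nu⁻¹ (Xsc K hnu (Δs K hc (Ls K nu⁻¹ f))) := by
  have h : (Φs K (n := n) nu).trans (Ψs K) = (((Ls K nu⁻¹).trans (Δs K hc)).trans (Xsc K hnu)).trans (Φs K nu⁻¹) :=
    algEquiv_ext_XY K
      (fun a => by
        simp only [AlgEquiv.trans_apply]
        rw [Φs_X, map_add, map_smul, Ψs_X, Ψs_Y, Ls_X, Δs_X, Xsc_X, map_smul, Φs_X, smul_add, smul_smul, mul_inv_cancel₀ hnu, one_smul, add_comm])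
      (fun a => by
        simp only [AlgEquiv.trans_apply, Φs_Y, Ψs_Y, Ls_Y, map_add, map_smul, Δs_Y, Δs_X, Xsc_Y, Xsc_X, Φs_X, smul_add, smul_smul]
        rw [inv_mul_cancel₀ hnu, one_smul, one_mul, neg_smul]
        abel)
  exact AlgEquiv.congr_fun h f

/-- **THE REVERSAL OF A NODE-`ν` CLASS IS A NODE-`ν⁻¹` CLASS: `w_n(rev_n (expMul ν q)) = w_n(expMul ν⁻¹ q′)`**, `q′ = xsSeq ν (scaleSeq (−ν⁻¹) (lowMul ν⁻¹ q))` — the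
sequence identity E9's header asked for, read off `Ψs_Φs` with E5/E7/E12/F1's class actions (no binomial identity is proved). -/
theorem w_rev_expMul {nu : K} (hnu : nu ≠ 0) (q : ℕ → K) :
    w K n n (rev K n (expMul K nu q)) = w K n n (expMul K nu⁻¹ (xsSeq K n nu (scaleSeq K (-nu⁻¹) (lowMul K n nu⁻¹ q)))) := by
  have hc : -nu⁻¹ ≠ 0 := neg_ne_zero.mpr (inv_ne_zero hnu)
  have h := Ψs_Φs K hnu hc (w K n n q)
  rwa [Φs_w K nu le_rfl, Ψs_w K le_rfl, Ls_w, Δs_w K hc le_rfl, Xsc_w, Φs_w K nu⁻¹ le_rfl] at h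

/-- the transported coefficient sequence `q′` vanishes beyond `P` if `q` does … -/
lemma mobSeq_apply_eq_zero (nu : K) {P : ℕ} {q : ℕ → K} (hq : ∀ j, P < j → q j = 0) {j : ℕ} (hj : P < j) :
    xsSeq K n nu (scaleSeq K (-nu⁻¹) (lowMul K n nu⁻¹ q)) j = 0 :=
  xsSeq_apply_eq_zero K nu (fun i hi => by rw [scaleSeq, lowMul_apply_eq_zero K _ hq hi, mul_zero]) hj

/-- … and its `P`-th entry is `ν^{n−P} (−ν⁻¹)^P q_P` (`P ≤ n`). -/
lemma mobSeq_apply_self (nu : K) {P : ℕ} (hP : P ≤ n) {q : ℕ → K} (hq : ∀ j, P < j → q j = 0) :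
    xsSeq K n nu (scaleSeq K (-nu⁻¹) (lowMul K n nu⁻¹ q)) P = nu ^ (n - P) * ((-nu⁻¹) ^ P * q P) := by
  rw [xsSeq_apply_self K nu hP, scaleSeq, lowMul_apply_self K _ hP hq]

/-- **THE KERNEL OF THE REVERSED NODE-`ν` CLASS: `Kr(univ, w_n(rev_n (expMul ν q)), k) = SI_k ⊔ Φs ν⁻¹ (xRich(k, P))`** for `q` of exact order `P`, `k + P ≤ n`, `ν ≠ 0` —
the reversed class is an order-`(P+1)` node at `ν⁻¹` (E5's confluent law at that node). -/
theorem Kr_w_rev_expMul_of_order {nu : K} (hnu : nu ≠ 0) {k P : ℕ} (hkP : k + P ≤ n) {q : ℕ → K} (hq : ∀ j, P < j → q j = 0) (hqP : q P ≠ 0) :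
    Kr K Finset.univ (w K n n (rev K n (expMul K nu q))) k = siegelIdeal K n k ⊔ (xRich K n k P).map (Φs K (n := n) nu⁻¹).toLinearMap := by
  rw [w_rev_expMul K hnu q]
  refine Kr_w_expMul_of_order K nu⁻¹ hkP (fun j hj => mobSeq_apply_eq_zero K nu hq hj) ?_
  rw [mobSeq_apply_self K nu (by omega) hq]
  exact mul_ne_zero (pow_ne_zero _ hnu) (mul_ne_zero (pow_ne_zero _ (neg_ne_zero.mpr (inv_ne_zero hnu))) hqP)

/-- … and its Hankel rank is unchanged (E12's `rank_hankel1_rev`, for the record next to the kernel). -/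
theorem rank_hankel1_rev_expMul_of_order {nu : K} {k P : ℕ} (hkP : k + P ≤ n) {q : ℕ → K} (hq : ∀ j, P < j → q j = 0) (hqP : q P ≠ 0) :
    (hankel1 K n k (rev K n (expMul K nu q))).rank = min P k + 1 := by
  rw [rank_hankel1_rev, rank_hankel1_expMul_of_order K nu hkP hq hqP]

/-! ## §76. The scaling and the lower shear on node classes -/

/-- **`scaleSeq m (expMul ν r) = expMul (mν) (scaleSeq m r)`**: the scaling `Δs m` moves a node-`ν` class to the node `mν`, same order (E12's `Δs_uvec` on classes). -/
theorem scaleSeq_expMul (m nu : K) (r : ℕ → K) (j : ℕ) : scaleSeq K m (expMul K nu r) j = expMul K (m * nu) (scaleSeq K m r) j := by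
  rw [scaleSeq, expMul_eq_sum, expMul_eq_sum, Finset.mul_sum]
  refine Finset.sum_congr rfl fun i hi => ?_
  rw [Finset.mem_range] at hi
  rw [scaleSeq, mul_pow, show m ^ j = m ^ (j - i) * m ^ i by rw [← pow_add, Nat.sub_add_cancel (by omega)]]
  ring

/-- hence `Kr(univ, w_n(scaleSeq m (expMul ν q)), k) = SI_k ⊔ Φs (mν) (xRich(k, P))` for `q` of exact order `P`, `m ≠ 0`, `k + P ≤ n`. -/
theorem Kr_w_scaleSeq_expMul_of_order {m : K} (hm : m ≠ 0) (nu : K) {k P : ℕ} (hkP : k + P ≤ n) {q : ℕ → K} (hq : ∀ j, P < j → q j = 0) (hqP : q P ≠ 0) :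
    Kr K Finset.univ (w K n n (scaleSeq K m (expMul K nu q))) k = siegelIdeal K n k ⊔ (xRich K n k P).map (Φs K (n := n) (m * nu)).toLinearMap := by
  have e : scaleSeq K m (expMul K nu q) = expMul K (m * nu) (scaleSeq K m q) := funext (scaleSeq_expMul K m nu q)
  rw [e]
  exact Kr_w_expMul_of_order K (m * nu) hkP (fun j hj => by rw [scaleSeq, hq j hj, mul_zero]) (by rw [scaleSeq]; exact mul_ne_zero (pow_ne_zero _ hm) hqP)

/-- **THE LOWER SHEAR PAST THE FRAME CHANGE: `Ls c ∘ Φs ν = Φs (ν(1+cν)⁻¹) ∘ Xsc (1+cν) ∘ Δs (1+cν)⁻¹ ∘ Ls (c(1+cν)⁻¹)`** for `1 + cν ≠ 0` — the node `ν` goes to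
`ν/(1 + cν)` (for `1 + cν = 0` it goes to `∞`: F1's `Ls_neg_Φs`). -/
theorem Ls_Φs (c nu : K) (he : 1 + c * nu ≠ 0) (he' : (1 + c * nu)⁻¹ ≠ 0) (f : HT K (In n)) :
    Ls K c (Φs K nu f) = Φs K (nu * (1 + c * nu)⁻¹) (Xsc K he (Δs K he' (Ls K (c * (1 + c * nu)⁻¹) f))) := by
  have h : (Φs K (n := n) nu).trans (Ls K c) =
      (((Ls K (c * (1 + c * nu)⁻¹)).trans (Δs K he')).trans (Xsc K he)).trans (Φs K (nu * (1 + c * nu)⁻¹)) :=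
    algEquiv_ext_XY K
      (fun a => by
        simp only [AlgEquiv.trans_apply, Φs_X, map_add, map_smul, Ls_X, Ls_Y, Δs_X, Xsc_X, smul_add, smul_smul]
        have e1 : (1 + c * nu) * (nu * (1 + c * nu)⁻¹) = nu := by field_simp
        rw [e1, add_smul, one_smul, show nu * c = c * nu from mul_comm _ _]; abel)
      (fun a => by
        simp only [AlgEquiv.trans_apply, Φs_Y, Ls_Y, map_add, map_smul, Δs_Y, Δs_X, Xsc_Y, Xsc_X, Φs_X, smul_add, smul_smul]
        have e2 : c * (1 + c * nu)⁻¹ * (1 + c * nu) = c := by field_simp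
        have e3 : (1 + c * nu)⁻¹ + c * (nu * (1 + c * nu)⁻¹) = 1 := by field_simp
        rw [e2, add_comm ((1 + c * nu)⁻¹ • Y K n ↑a), add_assoc, ← add_smul, add_comm (c * _), e3, one_smul, add_comm])
  exact AlgEquiv.congr_fun h f

/-- hence **`w_lowMul_expMul`: `w_n(lowMul c (expMul ν q)) = w_n(expMul (ν(1+cν)⁻¹) q″)`**, `q″ = xsSeq (1+cν) (scaleSeq (1+cν)⁻¹ (lowMul (c(1+cν)⁻¹) q))` — the lower
shear moves a node-`ν` class to a node-`ν/(1+cν)` class of the same order (`1 + cν ≠ 0`). -/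
theorem w_lowMul_expMul (c nu : K) (he : 1 + c * nu ≠ 0) (q : ℕ → K) :
    w K n n (lowMul K n c (expMul K nu q)) =
      w K n n (expMul K (nu * (1 + c * nu)⁻¹) (xsSeq K n (1 + c * nu) (scaleSeq K (1 + c * nu)⁻¹ (lowMul K n (c * (1 + c * nu)⁻¹) q)))) := by
  have he' : (1 + c * nu)⁻¹ ≠ 0 := inv_ne_zero he
  have h := Ls_Φs K c nu he he' (w K n n q)
  rwa [Φs_w K nu le_rfl, Ls_w, Ls_w, Δs_w K he' le_rfl, Xsc_w, Φs_w K _ le_rfl] at h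

/-- and its kernel: **`Kr(univ, w_n(lowMul c (expMul ν q)), k) = SI_k ⊔ Φs (ν(1+cν)⁻¹) (xRich(k, P))`** for `q` of exact order `P`, `k + P ≤ n`, `1 + cν ≠ 0`. -/
theorem Kr_w_lowMul_expMul_of_order (c nu : K) (he : 1 + c * nu ≠ 0) {k P : ℕ} (hkP : k + P ≤ n) {q : ℕ → K} (hq : ∀ j, P < j → q j = 0)
    (hqP : q P ≠ 0) :
    Kr K Finset.univ (w K n n (lowMul K n c (expMul K nu q))) k = siegelIdeal K n k ⊔ (xRich K n k P).map (Φs K (n := n) (nu * (1 + c * nu)⁻¹)).toLinearMap := by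
  have he' : (1 + c * nu)⁻¹ ≠ 0 := inv_ne_zero he
  rw [w_lowMul_expMul K c nu he q]
  refine Kr_w_expMul_of_order K _ hkP
    (fun j hj => xsSeq_apply_eq_zero K _ (fun i hi => by rw [scaleSeq, lowMul_apply_eq_zero K _ hq hi, mul_zero]) hj) ?_
  rw [xsSeq_apply_self K _ (by omega), scaleSeq, lowMul_apply_self K _ (by omega) hq]
  exact mul_ne_zero (pow_ne_zero _ he) (mul_ne_zero (pow_ne_zero _ he') hqP)

end Summit.Ventures.HSemireg.Wedge.HankelFrameChange
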